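import Summits.CriticalPhenomena.PercolationContinuityZ3.Theorems.PercNearOneGluingNoHeavyLowerTailSahiE3DimerPacking
import Mathlib.Tactic.Linarith
import Mathlib.Tactic.Ring
import Mathlib.Tactic.Positivity
import HarnessLib
import HarnessLib.Audit

/-!
# `NoHeavyLowerTail` (crux stmt-CriticalPhenomena-4575), Sahi programme P4: the 2×2 exchange lemma — crossing identity and the crossing-free case

Support file (cell `prim-l12`, seat P4, generation 20; `--supports stmt-CriticalPhenomena-4575`).  No named facts, no sorries;
standard axioms; def-free.

Context (HOME prim-l12-p4/FROM-prim-l12-p4-gen20-OR-PEEL.md).  The exact OR-peel of the mixed coefficient `Z*` of the AND-gluing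
composite (gen 18–19, `…SahiE3TwoLayerBernstein`) reduces the certificate of `V ∨ (y ∧ (z₁ ∨ ⋯ ∨ z_m))` — in particular the flagship
`(x₀∧(x₁∨x₂)) ∨ (y₀∧(y₁∨y₂))` — to two explicit inequalities `D₁, D₂ ≥ 0`; at the base of the peel (`G' = ∅`) they are the
"2×2 EXCHANGE LEMMA" on a Harris block `(B, w, V)` with a pair-certificate `R` (`R ≥ 0` on `V`,
`R(X∩Y∩V) ≥ need(X,Y) := w(X)w(Y∩V) + w(Y)w(X∩V) − w(V)w(X)w(Y)` for up-sets): for up-sets `O ⊆ K∩L`, `K∪L ⊆ P` and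
`O' ⊆ K'∩L'`, `K'∪L' ⊆ P'`,
  `w(PP'V) + w(OO'V) − w(P)w(O'V) − w(P')w(OV) + R(KK'V) + R(LL'V) − need(K,L') − need(L,K') + (1−v)·[Har(P,P') + products] ≥ 0`.
This file proves (i) the CROSSING IDENTITY behind it — with the diagonal crossing cells `Ξ₁ = V∩(K∖L)∩(L'∖K')`,
`Ξ₂ = V∩(L∖K)∩(K'∖L')` and parallel cells `C₁ = V∩(K∖L)∩(K'∖L')`, `C₂ = V∩(L∖K)∩(L'∖K')`,
  `R(KK'V) + R(LL'V) + R(Ξ₁) + R(Ξ₂) = R(KL'V) + R(LK'V) + R(C₁) + R(C₂)`   (`exchange_cross_identity`),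
(ii) the modularity of a nonnegative weight over a product of nested differences (`modularity_nested`), and (iii) the exchange
lemma in the CROSSING-FREE case `Ξ₁ = Ξ₂ = ∅` for both bracket shapes used by the peel (`exchange_of_noCross₂`,
`exchange_of_noCross₁`): there the cross packing `(K,L'), (L,K')` is admissible and the remaining "base" is a sum of two Harris
slacks, one modularity term and nonnegative products.  The general case (Ξ ≠ ∅; numerically always true, LP over the whole
pair-polytope, HOME memo §0) is the open combinatorial lemma of the programme and is NOT claimed here.
-/

namespace Summit.CriticalPhenomena.PercolationContinuityZ3.Theorems.SahiE3ExchangeCross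

open Finset SahiE3DimerPacking
open scoped BigOperators

variable {B : Type*} [DecidableEq B]

/-- **Crossing identity.**  For any weight `R` and finite sets `V, K, L, K', L'`:
`R(K∩K'∩V) + R(L∩L'∩V) + R(Ξ₁) + R(Ξ₂) = R(K∩L'∩V) + R(L∩K'∩V) + R(C₁) + R(C₂)` with the crossing cells
`Ξ₁ = (K∖L)∩(L'∖K')∩V`, `Ξ₂ = (L∖K)∩(K'∖L')∩V` and the parallel cells `C₁ = (K∖L)∩(K'∖L')∩V`, `C₂ = (L∖K)∩(L'∖K')∩V`
(pointwise `kk' + ll' − kl' − lk' = (k−l)(k'−l')`). [this work] -/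
theorem exchange_cross_identity (R : B → ℝ) (V K L K' L' : Finset B) :
    ∑ b ∈ (K ∩ K') ∩ V, R b + ∑ b ∈ (L ∩ L') ∩ V, R b
      + ∑ b ∈ ((K \ L) ∩ (L' \ K')) ∩ V, R b + ∑ b ∈ ((L \ K) ∩ (K' \ L')) ∩ V, R b
    = ∑ b ∈ (K ∩ L') ∩ V, R b + ∑ b ∈ (L ∩ K') ∩ V, R b
      + ∑ b ∈ ((K \ L) ∩ (K' \ L')) ∩ V, R b + ∑ b ∈ ((L \ K) ∩ (L' \ K')) ∩ V, R b := by
  simp only [sum_inter_eq_sum_ite, ← Finset.sum_add_distrib]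
  refine Finset.sum_congr rfl fun b _ => ?_
  simp only [Finset.mem_inter, Finset.mem_sdiff]
  by_cases hk : b ∈ K <;> by_cases hl : b ∈ L <;> by_cases hk' : b ∈ K' <;> by_cases hl' : b ∈ L' <;>
    simp [hk, hl, hk', hl']

/-- **Crossing-free packing.**  If `R ≥ 0` on `V` and `V` contains no crossing point (`Ξ₁ = Ξ₂ = ∅`), the cross pairs are
dominated by the same-index supplies: `R(K∩L'∩V) + R(L∩K'∩V) ≤ R(K∩K'∩V) + R(L∩L'∩V)`. [this work] -/
theorem cross_le_same_of_noCross (R : B → ℝ) (V K L K' L' : Finset B) (hR : ∀ b ∈ V, 0 ≤ R b)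
    (hΞ₁ : ((K \ L) ∩ (L' \ K')) ∩ V = ∅) (hΞ₂ : ((L \ K) ∩ (K' \ L')) ∩ V = ∅) :
    ∑ b ∈ (K ∩ L') ∩ V, R b + ∑ b ∈ (L ∩ K') ∩ V, R b
      ≤ ∑ b ∈ (K ∩ K') ∩ V, R b + ∑ b ∈ (L ∩ L') ∩ V, R b := by
  have key := exchange_cross_identity R V K L K' L'
  rw [hΞ₁, hΞ₂, Finset.sum_empty, add_zero, add_zero] at key
  have h1 : 0 ≤ ∑ b ∈ ((K \ L) ∩ (K' \ L')) ∩ V, R b :=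
    Finset.sum_nonneg fun b hb => hR b (Finset.mem_inter.1 hb).2
  have h2 : 0 ≤ ∑ b ∈ ((L \ K) ∩ (L' \ K')) ∩ V, R b :=
    Finset.sum_nonneg fun b hb => hR b (Finset.mem_inter.1 hb).2
  linarith

/-- **Modularity over nested differences.**  For `w ≥ 0` on `V` and `O ⊆ P`, `O' ⊆ P'`:
`w(P∩P'∩V) + w(O∩O'∩V) ≥ w(P∩O'∩V) + w(O∩P'∩V)` (pointwise `(p−o)(p'−o') ≥ 0`). [folklore] -/
theorem modularity_nested (w : B → ℝ) (V P O P' O' : Finset B) (hw : ∀ b ∈ V, 0 ≤ w b)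
    (hO : O ⊆ P) (hO' : O' ⊆ P') :
    ∑ b ∈ (P ∩ O') ∩ V, w b + ∑ b ∈ (O ∩ P') ∩ V, w b
      ≤ ∑ b ∈ (P ∩ P') ∩ V, w b + ∑ b ∈ (O ∩ O') ∩ V, w b := by
  simp only [sum_inter_eq_sum_ite, ← Finset.sum_add_distrib]
  refine Finset.sum_le_sum fun b hb => ?_
  have hwb := hw b hb
  simp only [Finset.mem_inter]
  by_cases hp : b ∈ P <;> by_cases ho : b ∈ O <;> by_cases hp' : b ∈ P' <;> by_cases ho' : b ∈ O' <;>
    simp only [hp, ho, hp', ho', and_true, and_false, and_self, ↓reduceIte, add_zero, zero_add, le_refl] <;>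
    first
      | exact absurd (hO ho) hp
      | exact absurd (hO' ho') hp'
      | linarith

omit [DecidableEq B] in
/-- A sum over a subset is at most the sum over the set, for a nonnegative weight. [folklore] -/
theorem sum_le_sum_of_subset' (w : B → ℝ) (hw : ∀ b, 0 ≤ w b) {X Y : Finset B} (h : X ⊆ Y) :
    ∑ b ∈ X, w b ≤ ∑ b ∈ Y, w b :=
  Finset.sum_le_sum_of_subset_of_nonneg h fun b _ _ => hw b

/-- **The 2×2 exchange lemma, crossing-free case, bracket of type 2.**  `B` finite with a weight `w ≥ 0` of total mass `1`,
`V ⊆ B` (the slot, `v = w(V)`), `R ≥ 0` on `V` satisfying the pair inequality at the two cross pairs `(K,L')`, `(L,K')`,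
Harris' inequality for the three pairs `(P, O'∩V)`, `(P', O∩V)`, `(P,P')`, nested sets `O ⊆ P ⊇ K, L` and `O' ⊆ P' ⊇ K', L'`, and
NO crossing point in `V`.  Then
`w(PP'V) + w(OO'V) − w(P)w(O'V) − w(P')w(OV) + R(KK'V) + R(LL'V) − need(K,L') − need(L,K') + (1−v)[w(PP') − pp' + (p−k)(p'−l') + (p−l)(p'−k')] ≥ 0`.
[this work] -/
theorem exchange_of_noCross₂ [Fintype B] (w R : B → ℝ) (hw : ∀ b, 0 ≤ w b) (hw1 : ∑ b, w b = 1)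
    (V K L P O K' L' P' O' : Finset B) (hR : ∀ b ∈ V, 0 ≤ R b)
    (hOP : O ⊆ P) (hKP : K ⊆ P) (hLP : L ⊆ P) (hOP' : O' ⊆ P') (hKP' : K' ⊆ P') (hLP' : L' ⊆ P')
    (hΞ₁ : ((K \ L) ∩ (L' \ K')) ∩ V = ∅) (hΞ₂ : ((L \ K) ∩ (K' \ L')) ∩ V = ∅)
    (hpair₁ : (∑ b ∈ K, w b) * (∑ b ∈ L' ∩ V, w b) + (∑ b ∈ L', w b) * (∑ b ∈ K ∩ V, w b)
        - (∑ b ∈ V, w b) * (∑ b ∈ K, w b) * (∑ b ∈ L', w b) ≤ ∑ b ∈ (K ∩ L') ∩ V, R b)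
    (hpair₂ : (∑ b ∈ L, w b) * (∑ b ∈ K' ∩ V, w b) + (∑ b ∈ K', w b) * (∑ b ∈ L ∩ V, w b)
        - (∑ b ∈ V, w b) * (∑ b ∈ L, w b) * (∑ b ∈ K', w b) ≤ ∑ b ∈ (L ∩ K') ∩ V, R b)
    (hHar₁ : (∑ b ∈ P, w b) * (∑ b ∈ O' ∩ V, w b) ≤ ∑ b ∈ (P ∩ O') ∩ V, w b)
    (hHar₂ : (∑ b ∈ P', w b) * (∑ b ∈ O ∩ V, w b) ≤ ∑ b ∈ (O ∩ P') ∩ V, w b)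
    (hHar₃ : (∑ b ∈ P, w b) * (∑ b ∈ P', w b) ≤ ∑ b ∈ P ∩ P', w b) :
    0 ≤ (∑ b ∈ (P ∩ P') ∩ V, w b) + (∑ b ∈ (O ∩ O') ∩ V, w b)
        - (∑ b ∈ P, w b) * (∑ b ∈ O' ∩ V, w b) - (∑ b ∈ P', w b) * (∑ b ∈ O ∩ V, w b)
        + (∑ b ∈ (K ∩ K') ∩ V, R b) + (∑ b ∈ (L ∩ L') ∩ V, R b)
        - ((∑ b ∈ K, w b) * (∑ b ∈ L' ∩ V, w b) + (∑ b ∈ L', w b) * (∑ b ∈ K ∩ V, w b)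
            - (∑ b ∈ V, w b) * (∑ b ∈ K, w b) * (∑ b ∈ L', w b))
        - ((∑ b ∈ L, w b) * (∑ b ∈ K' ∩ V, w b) + (∑ b ∈ K', w b) * (∑ b ∈ L ∩ V, w b)
            - (∑ b ∈ V, w b) * (∑ b ∈ L, w b) * (∑ b ∈ K', w b))
        + (1 - ∑ b ∈ V, w b) * ((∑ b ∈ P ∩ P', w b) - (∑ b ∈ P, w b) * (∑ b ∈ P', w b)
            + ((∑ b ∈ P, w b) - ∑ b ∈ K, w b) * ((∑ b ∈ P', w b) - ∑ b ∈ L', w b)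
            + ((∑ b ∈ P, w b) - ∑ b ∈ L, w b) * ((∑ b ∈ P', w b) - ∑ b ∈ K', w b)) := by
  have hcross := cross_le_same_of_noCross R V K L K' L' hR hΞ₁ hΞ₂
  have hmod := modularity_nested w V P O P' O' (fun b _ => hw b) hOP hOP'
  have hv1 : ∑ b ∈ V, w b ≤ 1 := by
    rw [← hw1]; exact sum_le_sum_of_subset' w hw (Finset.subset_univ V)
  have hk : ∑ b ∈ K, w b ≤ ∑ b ∈ P, w b := sum_le_sum_of_subset' w hw hKP
  have hl : ∑ b ∈ L, w b ≤ ∑ b ∈ P, w b := sum_le_sum_of_subset' w hw hLP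
  have hk' : ∑ b ∈ K', w b ≤ ∑ b ∈ P', w b := sum_le_sum_of_subset' w hw hKP'
  have hl' : ∑ b ∈ L', w b ≤ ∑ b ∈ P', w b := sum_le_sum_of_subset' w hw hLP'
  have e1 : 0 ≤ (1 - ∑ b ∈ V, w b) * ((∑ b ∈ P ∩ P', w b) - (∑ b ∈ P, w b) * (∑ b ∈ P', w b)) :=
    mul_nonneg (by linarith) (by linarith)
  have e2 : 0 ≤ (1 - ∑ b ∈ V, w b) * (((∑ b ∈ P, w b) - ∑ b ∈ K, w b) * ((∑ b ∈ P', w b) - ∑ b ∈ L', w b)) :=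
    mul_nonneg (by linarith) (mul_nonneg (by linarith) (by linarith))
  have e3 : 0 ≤ (1 - ∑ b ∈ V, w b) * (((∑ b ∈ P, w b) - ∑ b ∈ L, w b) * ((∑ b ∈ P', w b) - ∑ b ∈ K', w b)) :=
    mul_nonneg (by linarith) (mul_nonneg (by linarith) (by linarith))
  nlinarith [hcross, hmod, hpair₁, hpair₂, hHar₁, hHar₂, e1, e2, e3]

/-- **The 2×2 exchange lemma, crossing-free case, bracket of type 1** (the shape of `D₁`): same hypotheses plus `O' ⊆ K'`,
with the bracket `[w(PP') − pp' + (p−k)(k'−o') + (p−o)(p'−k')]`. [this work] -/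
theorem exchange_of_noCross₁ [Fintype B] (w R : B → ℝ) (hw : ∀ b, 0 ≤ w b) (hw1 : ∑ b, w b = 1)
    (V K L P O K' L' P' O' : Finset B) (hR : ∀ b ∈ V, 0 ≤ R b)
    (hOP : O ⊆ P) (hKP : K ⊆ P) (hOP' : O' ⊆ P') (hOK' : O' ⊆ K') (hKP' : K' ⊆ P')
    (hΞ₁ : ((K \ L) ∩ (L' \ K')) ∩ V = ∅) (hΞ₂ : ((L \ K) ∩ (K' \ L')) ∩ V = ∅)
    (hpair₁ : (∑ b ∈ K, w b) * (∑ b ∈ L' ∩ V, w b) + (∑ b ∈ L', w b) * (∑ b ∈ K ∩ V, w b)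
        - (∑ b ∈ V, w b) * (∑ b ∈ K, w b) * (∑ b ∈ L', w b) ≤ ∑ b ∈ (K ∩ L') ∩ V, R b)
    (hpair₂ : (∑ b ∈ L, w b) * (∑ b ∈ K' ∩ V, w b) + (∑ b ∈ K', w b) * (∑ b ∈ L ∩ V, w b)
        - (∑ b ∈ V, w b) * (∑ b ∈ L, w b) * (∑ b ∈ K', w b) ≤ ∑ b ∈ (L ∩ K') ∩ V, R b)
    (hHar₁ : (∑ b ∈ P, w b) * (∑ b ∈ O' ∩ V, w b) ≤ ∑ b ∈ (P ∩ O') ∩ V, w b)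
    (hHar₂ : (∑ b ∈ P', w b) * (∑ b ∈ O ∩ V, w b) ≤ ∑ b ∈ (O ∩ P') ∩ V, w b)
    (hHar₃ : (∑ b ∈ P, w b) * (∑ b ∈ P', w b) ≤ ∑ b ∈ P ∩ P', w b) :
    0 ≤ (∑ b ∈ (P ∩ P') ∩ V, w b) + (∑ b ∈ (O ∩ O') ∩ V, w b)
        - (∑ b ∈ P, w b) * (∑ b ∈ O' ∩ V, w b) - (∑ b ∈ P', w b) * (∑ b ∈ O ∩ V, w b)
        + (∑ b ∈ (K ∩ K') ∩ V, R b) + (∑ b ∈ (L ∩ L') ∩ V, R b)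
        - ((∑ b ∈ K, w b) * (∑ b ∈ L' ∩ V, w b) + (∑ b ∈ L', w b) * (∑ b ∈ K ∩ V, w b)
            - (∑ b ∈ V, w b) * (∑ b ∈ K, w b) * (∑ b ∈ L', w b))
        - ((∑ b ∈ L, w b) * (∑ b ∈ K' ∩ V, w b) + (∑ b ∈ K', w b) * (∑ b ∈ L ∩ V, w b)
            - (∑ b ∈ V, w b) * (∑ b ∈ L, w b) * (∑ b ∈ K', w b))
        + (1 - ∑ b ∈ V, w b) * ((∑ b ∈ P ∩ P', w b) - (∑ b ∈ P, w b) * (∑ b ∈ P', w b)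
            + ((∑ b ∈ P, w b) - ∑ b ∈ K, w b) * ((∑ b ∈ K', w b) - ∑ b ∈ O', w b)
            + ((∑ b ∈ P, w b) - ∑ b ∈ O, w b) * ((∑ b ∈ P', w b) - ∑ b ∈ K', w b)) := by
  have hcross := cross_le_same_of_noCross R V K L K' L' hR hΞ₁ hΞ₂
  have hmod := modularity_nested w V P O P' O' (fun b _ => hw b) hOP hOP'
  have hv1 : ∑ b ∈ V, w b ≤ 1 := by
    rw [← hw1]; exact sum_le_sum_of_subset' w hw (Finset.subset_univ V)
  have hk : ∑ b ∈ K, w b ≤ ∑ b ∈ P, w b := sum_le_sum_of_subset' w hw hKP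
  have ho : ∑ b ∈ O, w b ≤ ∑ b ∈ P, w b := sum_le_sum_of_subset' w hw hOP
  have ho' : ∑ b ∈ O', w b ≤ ∑ b ∈ K', w b := sum_le_sum_of_subset' w hw hOK'
  have hk' : ∑ b ∈ K', w b ≤ ∑ b ∈ P', w b := sum_le_sum_of_subset' w hw hKP'
  have e1 : 0 ≤ (1 - ∑ b ∈ V, w b) * ((∑ b ∈ P ∩ P', w b) - (∑ b ∈ P, w b) * (∑ b ∈ P', w b)) :=
    mul_nonneg (by linarith) (by linarith)
  have e2 : 0 ≤ (1 - ∑ b ∈ V, w b) * (((∑ b ∈ P, w b) - ∑ b ∈ K, w b) * ((∑ b ∈ K', w b) - ∑ b ∈ O', w b)) :=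
    mul_nonneg (by linarith) (mul_nonneg (by linarith) (by linarith))
  have e3 : 0 ≤ (1 - ∑ b ∈ V, w b) * (((∑ b ∈ P, w b) - ∑ b ∈ O, w b) * ((∑ b ∈ P', w b) - ∑ b ∈ K', w b)) :=
    mul_nonneg (by linarith) (mul_nonneg (by linarith) (by linarith))
  nlinarith [hcross, hmod, hpair₁, hpair₂, hHar₁, hHar₂, e1, e2, e3]

/-- **The top coefficient `C₃ = Z*_{V,TRUE} ≥ 0` of the OR-peel** (`…SahiE3ZstarOrPeel.zstar_or_peel` with the natural data
`T₂ = 1_V·w + v̄·w`, `F₂ = 1_V·w`, `v = 1 − v̄`): for `w ≥ 0`, `L ⊆ P`, `L' ⊆ P'`, `v̄ ≥ 0` and Harris' inequality for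
`(P, L'∩V)`, `(P', L∩V)`, `(P, P')`,
`w(PP'V) + v̄w(PP') + w(LL'V) + (1−v̄)(p·l' + l·p') + v̄(l·l' − (p−l)(p'−l')) − p·w(L'V) − p'·w(LV) − l·p' − l'·p ≥ 0`
(it equals `[modularity] + Har(P;L'_V) + Har(P';L_V) + v̄·Har(P,P')`, gen-19 memo F5). [this work] -/
theorem zstarTrue_nonneg (w : B → ℝ) (V P L P' L' : Finset B) (hw : ∀ b ∈ V, 0 ≤ w b)
    (hLP : L ⊆ P) (hLP' : L' ⊆ P') {vb : ℝ} (hvb : 0 ≤ vb)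
    (hHar₁ : (∑ b ∈ P, w b) * (∑ b ∈ L' ∩ V, w b) ≤ ∑ b ∈ (P ∩ L') ∩ V, w b)
    (hHar₂ : (∑ b ∈ P', w b) * (∑ b ∈ L ∩ V, w b) ≤ ∑ b ∈ (L ∩ P') ∩ V, w b)
    (hHar₃ : (∑ b ∈ P, w b) * (∑ b ∈ P', w b) ≤ ∑ b ∈ P ∩ P', w b) :
    0 ≤ (∑ b ∈ (P ∩ P') ∩ V, w b) + vb * (∑ b ∈ P ∩ P', w b) + (∑ b ∈ (L ∩ L') ∩ V, w b)
        + (1 - vb) * ((∑ b ∈ P, w b) * (∑ b ∈ L', w b) + (∑ b ∈ L, w b) * (∑ b ∈ P', w b))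
        + vb * ((∑ b ∈ L, w b) * (∑ b ∈ L', w b)
            - ((∑ b ∈ P, w b) - ∑ b ∈ L, w b) * ((∑ b ∈ P', w b) - ∑ b ∈ L', w b))
        - (∑ b ∈ P, w b) * (∑ b ∈ L' ∩ V, w b) - (∑ b ∈ P', w b) * (∑ b ∈ L ∩ V, w b)
        - (∑ b ∈ L, w b) * (∑ b ∈ P', w b) - (∑ b ∈ L', w b) * (∑ b ∈ P, w b) := by
  have hmod := modularity_nested w V P L P' L' hw hLP hLP'
  have e1 : 0 ≤ vb * ((∑ b ∈ P ∩ P', w b) - (∑ b ∈ P, w b) * (∑ b ∈ P', w b)) := mul_nonneg hvb (by linarith)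
  have key : (∑ b ∈ (P ∩ P') ∩ V, w b) + vb * (∑ b ∈ P ∩ P', w b) + (∑ b ∈ (L ∩ L') ∩ V, w b)
        + (1 - vb) * ((∑ b ∈ P, w b) * (∑ b ∈ L', w b) + (∑ b ∈ L, w b) * (∑ b ∈ P', w b))
        + vb * ((∑ b ∈ L, w b) * (∑ b ∈ L', w b)
            - ((∑ b ∈ P, w b) - ∑ b ∈ L, w b) * ((∑ b ∈ P', w b) - ∑ b ∈ L', w b))
        - (∑ b ∈ P, w b) * (∑ b ∈ L' ∩ V, w b) - (∑ b ∈ P', w b) * (∑ b ∈ L ∩ V, w b)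
        - (∑ b ∈ L, w b) * (∑ b ∈ P', w b) - (∑ b ∈ L', w b) * (∑ b ∈ P, w b)
      = ((∑ b ∈ (P ∩ P') ∩ V, w b) + (∑ b ∈ (L ∩ L') ∩ V, w b) - (∑ b ∈ (P ∩ L') ∩ V, w b) - (∑ b ∈ (L ∩ P') ∩ V, w b))
        + ((∑ b ∈ (P ∩ L') ∩ V, w b) - (∑ b ∈ P, w b) * (∑ b ∈ L' ∩ V, w b))
        + ((∑ b ∈ (L ∩ P') ∩ V, w b) - (∑ b ∈ P', w b) * (∑ b ∈ L ∩ V, w b))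
        + vb * ((∑ b ∈ P ∩ P', w b) - (∑ b ∈ P, w b) * (∑ b ∈ P', w b)) := by ring
  rw [key]
  linarith

end Summit.CriticalPhenomena.PercolationContinuityZ3.Theorems.SahiE3ExchangeCross
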